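import Summits.QuantumFields.YangMills.Theorems.UnitScaleTiltProp7SectET3DeltaOneT3Rows
import Summits.QuantumFields.YangMills.Theorems.UnitScaleTiltProp7SectET3WilsonHessianT3RealityRows
import Summits.QuantumFields.YangMills.Theorems.UnitScaleTiltProp7SectET3OpsT3HilbertRows
import HarnessLib

/-!
# Route `UnitScaleTilt`, crux «MinimiserStabilityRegPr» (stmt-QuantumFields-19200, stub EX) ∕ (O″χ) B0 (stmt-QuantumFields-20520), node N06(d = 3), route (α) —
# LAYER 0, ROWS (def-free), L0e PART 5: **PRINT'S «G IS SELF-ADJOINT» ((3.27)∕(3.123)) FOR THE LAYER-0 LETTERS** — with brick L0b's `Δ^η(U₀)` symmetric (✓`DeltaEta_isSymmetric`): `Δ_π = PᵀΔP`,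
# `Δ₁ = Pᵀ(Δ + T_J)P` (for symmetric `T_J`) and `Δ_a = Δx + DR_SD* + Q*aQ` are symmetric on `L²`, hence so is `G = Δ_a⁻¹` on the class `PosOnto` (`G† = G`), for `G`, `G₁`

Cell `ym-inputs` (desk `pub/ym-inputs`, INPUT-LIST.md v6 §4 row p01; memo `pub/ym-inputs/DEFINER-MEMO-T3.md` §2 L0e).  THEOREMS ONLY (0 `def`, 0 `sorry`); `--supports stmt-QuantumFields-20520
--as helper`; count-neutral.  YM₃ on T³ is ladder rung R3, NOT the Clay problem; nothing here is a claim about a stub, a crux, d = 4 or the mass gap.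

WHAT IS PROVED (member `F`, `h : n ≤ K`, `c₀ cB a`, slot `Δx` ∕ `TJ`, background `U₀`): generic — `adjoint_GT` (`G† = G` on `PosOnto`), `inner_laplaceA_self_im`, REUSING the (α-S)∕p05 seat's
✓`Prop7SectET3OpsT3HilbertRows.laplaceA_isSymmetric` ∕ ✓`GT_isSymmetric` (generic in the slot; imported, not restated); instances — `DeltaPi_isSymmetric`, `DeltaPiSlot_isSymmetric`, `DeltaOne_isSymmetric` (symmetric `T_J`),
★★`Gpi_isSymmetric` ∕ `adjoint_Gpi` (print's `G` of (3.122)), ★`G1pi_isSymmetric` ∕ `adjoint_G1pi` (print's `G₁` of (3.128)), `laplaceA_pi_isSymmetric`, `inner_laplaceA_pi_self_im` (the quadratic form of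
`G⁻¹` is real, so `PosOnto.pos` is positivity of a real number).
HONEST SCOPE.  Finite-dimensional algebra; positivity itself ([B9] Thm 3.11) is N06's input; nothing of print asserted.

References: T. Bałaban, CMP **99** (1985) 389–434 [Balaban1985BackgroundPropagators] ((3.27) p.395, (3.119)–(3.123) pp.419–420, (3.128) p.421).
-/

set_option autoImplicit false

noncomputable section

open scoped InnerProductSpace ComplexConjugate Matrix.Norms.L2Operator

namespace Summit.QuantumFields.YangMills.Theorems.Prop7SectET3DeltaOne

open Literature.MathematicalPhysics.QuantumFieldTheory.Balaban1983to89
open Literature.MathematicalPhysics.QuantumFieldTheory.Balaban1983to89.T3ContinuumYM3Torus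
open T3SectALandauChart (eta)
open B11Eq103H1Complex (BondL2K)
open Summit.QuantumFields.YangMills.Theorems.Prop7SectET3Transport (periodsT3)
open Summit.QuantumFields.YangMills.Theorems.Prop7SectET3HilbertLetters (W₂)
open Summit.QuantumFields.YangMills.Theorems.Prop7SectET3CurvedPropagators
open Summit.QuantumFields.YangMills.Theorems.Prop7SectET3WilsonHessian (DeltaEta DeltaEta_isSymmetric)
open Summit.QuantumFields.YangMills.Theorems.Prop7SectET3DeltaPi (gaugeCorr DeltaPi DeltaPiSlot Gpi inner_DeltaPi)
open Summit.QuantumFields.YangMills.Theorems.Prop7SectET3OpsT3HilbertRows (laplaceA_isSymmetric GT_isSymmetric)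

variable {F : T3Family} {n K : ℕ} {h : n ≤ K} {c₀ cB a : ℝ} [Fact (0 < c₀)] [Fact (0 < cB)]
  {Δx : GaugeField (F.P K) 0 (Matrix.specialUnitaryGroup (Fin 2) ℂ) → (BondL2K ℂ 3 (periodsT3 F K) c₀ W₂ →ₗ[ℂ] BondL2K ℂ 3 (periodsT3 F K) c₀ W₂)}
  {TJ : GaugeField (F.P K) 0 (Matrix.specialUnitaryGroup (Fin 2) ℂ) → (BondL2K ℂ 3 (periodsT3 F K) c₀ W₂ →ₗ[ℂ] BondL2K ℂ 3 (periodsT3 F K) c₀ W₂)}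

/-! ## §1 Generic Hessian slot: `G† = G` and the reality of `⟨x, Δ_a x⟩` when `Δx(U₀)` is symmetric (✓`OpsT3HilbertRows.laplaceA_isSymmetric` ∕ `GT_isSymmetric`) -/

/-- **`G† = G` ON THE CLASS.** [cite: Balaban1985BackgroundPropagators, (3.123) p.420] -/
theorem adjoint_GT {U₀ : GaugeField (F.P K) 0 (Matrix.specialUnitaryGroup (Fin 2) ℂ)} (hp : PosOnto F n K h c₀ cB a Δx U₀) (hΔ : (Δx U₀).IsSymmetric) :
    LinearMap.adjoint (GT F n K h c₀ cB a Δx U₀) = GT F n K h c₀ cB a Δx U₀ :=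
  (GT_isSymmetric hp hΔ).adjoint_eq

/-- **THE QUADRATIC FORM OF `Δ_a` IS REAL** when `Δx(U₀)` is symmetric — so the positivity input `PosOnto.pos` concerns the real number `⟪x, Δ_ax⟫`. [cite: Balaban1985BackgroundPropagators, Thm 3.11 p.418] -/
theorem inner_laplaceA_self_im {U₀ : GaugeField (F.P K) 0 (Matrix.specialUnitaryGroup (Fin 2) ℂ)} (hΔ : (Δx U₀).IsSymmetric) (x : BondL2K ℂ 3 (periodsT3 F K) c₀ W₂) :
    (⟪x, laplaceA F n K h c₀ cB a Δx U₀ x⟫_ℂ).im = 0 := by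
  have hK := laplaceA_isSymmetric (h := h) (cB := cB) (a := a) hΔ
  have hc : conj ⟪x, laplaceA F n K h c₀ cB a Δx U₀ x⟫_ℂ = ⟪x, laplaceA F n K h c₀ cB a Δx U₀ x⟫_ℂ := by
    rw [inner_conj_symm, hK]
  exact Complex.conj_eq_iff_im.1 hc

/-! ## §2 The letters of record: `Δ_π`, `Δ₁`, print's `G` and `G₁` -/

omit [Fact (0 < cB)] in
/-- **`Δ_π = PᵀΔ^ηP` IS SYMMETRIC** (`Δ^η` is: ✓`DeltaEta_isSymmetric`). [cite: Balaban1985BackgroundPropagators, (3.119) p.419, (3.12) p.392] -/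
theorem DeltaPi_isSymmetric [Fact (0 < cB)] (U₀ : GaugeField (F.P K) 0 (Matrix.specialUnitaryGroup (Fin 2) ℂ)) : (DeltaPi F n K h c₀ cB a U₀).IsSymmetric := by
  intro x y
  have hs := DeltaEta_isSymmetric (n := n) (c₀ := c₀) U₀ (gaugeCorr F n K h c₀ cB a U₀ x) (gaugeCorr F n K h c₀ cB a U₀ y)
  simp only [ContinuousLinearMap.coe_coe] at hs
  rw [← inner_conj_symm, inner_DeltaPi, inner_conj_symm, hs, ← inner_DeltaPi]

/-- The slot form. [cite: Balaban1985BackgroundPropagators, (3.119) p.419] -/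
theorem DeltaPiSlot_isSymmetric (U₀ : GaugeField (F.P K) 0 (Matrix.specialUnitaryGroup (Fin 2) ℂ)) : (DeltaPiSlot F n K h c₀ cB a U₀).IsSymmetric :=
  DeltaPi_isSymmetric U₀

/-- **`Δ₁ = Pᵀ(Δ^η + T_J)P` IS SYMMETRIC for a symmetric J-term.** [cite: Balaban1985BackgroundPropagators, (3.128) p.421] -/
theorem DeltaOne_isSymmetric {U₀ : GaugeField (F.P K) 0 (Matrix.specialUnitaryGroup (Fin 2) ℂ)} (hT : (TJ U₀).IsSymmetric) : (DeltaOne F n K h c₀ cB a TJ U₀).IsSymmetric := by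
  intro x y
  have hs := DeltaEta_isSymmetric (n := n) (c₀ := c₀) U₀ (gaugeCorr F n K h c₀ cB a U₀ x) (gaugeCorr F n K h c₀ cB a U₀ y)
  simp only [ContinuousLinearMap.coe_coe] at hs
  rw [← inner_conj_symm, inner_DeltaOne, map_add, inner_conj_symm, inner_conj_symm, hs, hT, ← inner_DeltaOne]

/-- **`Δ_π + DR_SD* + Q*aQ = G⁻¹` IS SYMMETRIC.** [cite: Balaban1985BackgroundPropagators, (3.122)–(3.123) p.420] -/
theorem laplaceA_pi_isSymmetric (U₀ : GaugeField (F.P K) 0 (Matrix.specialUnitaryGroup (Fin 2) ℂ)) :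
    (laplaceA F n K h c₀ cB a (DeltaPiSlot F n K h c₀ cB a) U₀).IsSymmetric :=
  laplaceA_isSymmetric (DeltaPiSlot_isSymmetric U₀)

/-- ★★ **PRINT'S `G(U₀)` OF (3.122) IS SYMMETRIC ON THE CLASS** («G is a positive self-adjoint operator» modulo the positivity input). [cite: Balaban1985BackgroundPropagators, (3.123) p.420] -/
theorem Gpi_isSymmetric {U₀ : GaugeField (F.P K) 0 (Matrix.specialUnitaryGroup (Fin 2) ℂ)} (hp : PosOnto F n K h c₀ cB a (DeltaPiSlot F n K h c₀ cB a) U₀) :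
    (Gpi F n K h c₀ cB a U₀).IsSymmetric :=
  GT_isSymmetric hp (DeltaPiSlot_isSymmetric U₀)

/-- **`G† = G` for print's `G` on the class.** [cite: Balaban1985BackgroundPropagators, (3.123) p.420] -/
theorem adjoint_Gpi {U₀ : GaugeField (F.P K) 0 (Matrix.specialUnitaryGroup (Fin 2) ℂ)} (hp : PosOnto F n K h c₀ cB a (DeltaPiSlot F n K h c₀ cB a) U₀) :
    LinearMap.adjoint (Gpi F n K h c₀ cB a U₀) = Gpi F n K h c₀ cB a U₀ :=
  adjoint_GT hp (DeltaPiSlot_isSymmetric U₀)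

/-- ★ **PRINT'S `G₁(U₀)` OF (3.128) IS SYMMETRIC ON ITS CLASS** (symmetric J-term). [cite: Balaban1985BackgroundPropagators, (3.128) p.421] -/
theorem G1pi_isSymmetric {U₀ : GaugeField (F.P K) 0 (Matrix.specialUnitaryGroup (Fin 2) ℂ)} (hp : PosOnto F n K h c₀ cB a (DeltaOne F n K h c₀ cB a TJ) U₀)
    (hT : (TJ U₀).IsSymmetric) : (G1pi F n K h c₀ cB a TJ U₀).IsSymmetric :=
  GT_isSymmetric hp (DeltaOne_isSymmetric hT)

/-- **`G₁† = G₁` on the class.** [cite: Balaban1985BackgroundPropagators, (3.128) p.421] -/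
theorem adjoint_G1pi {U₀ : GaugeField (F.P K) 0 (Matrix.specialUnitaryGroup (Fin 2) ℂ)} (hp : PosOnto F n K h c₀ cB a (DeltaOne F n K h c₀ cB a TJ) U₀)
    (hT : (TJ U₀).IsSymmetric) : LinearMap.adjoint (G1pi F n K h c₀ cB a TJ U₀) = G1pi F n K h c₀ cB a TJ U₀ :=
  adjoint_GT hp (DeltaOne_isSymmetric hT)

/-- The quadratic form of print's `G⁻¹ = Δ_π + DRD* + Q*aQ` is real. [cite: Balaban1985BackgroundPropagators, Thm 3.11 p.418, (3.122) p.420] -/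
theorem inner_laplaceA_pi_self_im (U₀ : GaugeField (F.P K) 0 (Matrix.specialUnitaryGroup (Fin 2) ℂ)) (x : BondL2K ℂ 3 (periodsT3 F K) c₀ W₂) :
    (⟪x, laplaceA F n K h c₀ cB a (DeltaPiSlot F n K h c₀ cB a) U₀ x⟫_ℂ).im = 0 :=
  inner_laplaceA_self_im (DeltaPiSlot_isSymmetric U₀) x

end Summit.QuantumFields.YangMills.Theorems.Prop7SectET3DeltaOne

end
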